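import Literature.NumberTheory.IwasawaTheory.ClassGroupPRankLeOfRelationMatrix
import HarnessLib

/-!
# THE TWO-GENERATOR RELATION DOOR AT `p = 2`: `2 ∤ h_K` and at most THREE primes ramified in `K_1` give `rank₂ Cl(K_1) ≤ 2` for free; independence
# of two classes from THREE genus certificates (`c₁`, `c₂`, `c₁c₂`); base-field currency for an odd-degree `K` with `2 ∤ d_K`, `κ` cyclotomic

Topic `NumberTheory/IwasawaTheory` (namespace = path).  THEOREMS ONLY (no definition, no named fact, no instance, no `sorry`); unconditional.  Written by the prover
seat `bsd-line-att-p3` g54 (cell `bsd-f1-sign2`, WIDTH-5 attach on route `AlignedTransportAtTwo`, crux C2 stmt-BirchSwinnertonDyer-22298; `--supports`, closes nothing).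
`p = 2` packaging of this seat's `ClassGroupPRankLeOfRelationMatrix` (the TWO-GENERATOR relation door), parallel to att-p3 g53's one-generator packaging
`ClassGroupPRankLeOfRelationLayerOne` §2–§3.

* `FukudaRelation.forall_dvd_two_of_not_exists_eq_conj_div_mul_sq` — group lemma: `c₁, c₂, c₁c₂ ∉ α(b)b⁻¹·G²` ⟹ `c₁, c₂` are INDEPENDENT modulo `α(b)b⁻¹·G²`
  (`c₁^a c₂^b ∈ α(b')b'⁻¹·G² ⟹ 2 ∣ a, b`; reduce the exponents modulo `2`).
* ★ `classGroupPRank_one_le_two_of_ncard_le_three` — `κ` a `ℤ₂`-extension, `h_K` odd, at most THREE primes of `K` ramified in `K_1` ⟹ **`rank₂ Cl(K_1) ≤ 2`**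
  (the exact genus count `rank₂ Cl(K_1) + 1 + ord₂[E_K : E_K ∩ N K_1ˣ] = t₁` of `ClassGroupPRankLayerOneGenusJump` — NO unit datum needed).
* ★★★ `classicalMuVanishes_and_classicalLambda_le_of_relation_matrix_of_ncard_le_three` — `κ` with Fukuda index `0`, `h_K` odd, `t₁ ≤ 3`, a layer `n ≥ 1` with
  `d + 2 ≤ 2^n`, `σ` a generator, `c₁, c₂` independent modulo `σ(b)b⁻¹·Cl²`, a `2 × 2` relation matrix of determinant order `d` ⟹ **`rank₂ Cl(K_m) ≤ d ∀ m`, `μ₂(κ) = 0`,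
  `λ₂(κ) ≤ d`**.
* ★★★ `classicalMuVanishes_two_of_relation_matrix_of_three_genusCerts` — BASE-FIELD CURRENCY: `K` of odd degree, `2 ∤ d_K`, at most three primes above `2`, `κ`
  cyclotomic, `2 ∤ h_K`; THREE GENUS CERTIFICATES `(𝔭_j, π_j, 𝔄_j, k_j)` (`𝔭_j ∋ 2` maximal with `𝓞_K/𝔭_j = 𝔽₂` and every unit `≡ ±1 (mod 𝔭_j³)`, `π_j ≡ ±3 (mod 𝔭_j³)`,
  `N_{K_1/K}(𝔄_j)^{k_j} = (π_j)`, `N_{K_m/K_1}(c) = [𝔄_j]`) for the classes `c = c₁`, `c₂`, `c₁c₂` of `Cl(K_m)`; `σ` a generator of `Gal(K_m/K)`; a `2 × 2` RELATION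
  MATRIX `∏ σ^i(c₁)^{f_{j1}(i)} ∏ σ^i(c₂)^{f_{j2}(i)} = 1` (`j = 1,2`) with `F₁₁F₂₂ − F₁₂F₂₁ = (X−1)^d·u + 2·g`, `u(1)` odd, `d + 2 ≤ 2^m` ⟹ **`rank₂ Cl(K_l) ≤ d ∀ l`,
  `μ₂(κ) = 0`, `λ₂(κ) ≤ d`**.

HONEST SCOPE: classical (Washington §13.3 at finite level + genus theory, Gras IV.4); nothing specific to any summit; no class group of any field is computed here; BSD is not
advanced by this file.  USE (cell bsd-f1-sign2, crux C2): the split-stratum cubic `2`-division fields `ℚ(β)` (`Δ_W ≡ 1 (mod 8)`, three dyadic primes, `h` odd) whose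
fundamental unit is `≡ ±1 (mod 8)` at EVERY dyadic embedding — `rank₂ Cl(ℚ(β,√2)) = 2`, att-p3 g53 census: discriminant `−1727` (seeds `1727a1 / 29359b1 / 29359d1`);
there every dyadic prime carries genus certificates and the one-relation doors cannot fire.

## References

* L. C. Washington, *Introduction to Cyclotomic Fields*, 2nd ed. (1997), §13.3 Prop. 13.22–13.23. [Washington1997]
* G. Gras, *Class Field Theory* (2003), IV.4. [Gras2003]
* S. Lang, *Cyclotomic Fields I and II* (1990), Ch. 5 §3, Ch. 13 §4 Lemma 4.1. [Lang1990]
* T. Fukuda, *Remarks on `ℤ_p`-extensions of number fields*, Proc. Japan Acad. 70 A (1994), Thm. 1. [Fukuda1994]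
* O. T. O'Meara, *Introduction to Quadratic Forms* (1963), §63B. [Omeara1963]
* J. Neukirch, *Algebraic Number Theory* (1999), Ch. III (2.12). [NeukirchANT1999]
-/

set_option autoImplicit false

noncomputable section

open Polynomial Finset

/-! ## §1 Independence of two classes modulo `α(b)b⁻¹·G²` from three non-memberships -/

namespace Literature.NumberTheory.IwasawaTheory.FukudaRelation

/-- **Two classes are independent modulo `α(b)·b⁻¹·G²` as soon as `c₁`, `c₂` and `c₁c₂` lie outside it**: reduce `c₁^a c₂^b` modulo squares to
`c₁^{a mod 2} c₂^{b mod 2}`. [folklore] [cite: Lang1990, Ch. 13 §4 Lemma 4.1 (classes modulo `(σ−1)` and `p`-th powers)] -/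
theorem forall_dvd_two_of_not_exists_eq_conj_div_mul_sq {G : Type*} [CommGroup G] (α : G ≃* G) {c₁ c₂ : G}
    (h₁ : ¬ ∃ b e : G, c₁ = α b / b * e ^ 2) (h₂ : ¬ ∃ b e : G, c₂ = α b / b * e ^ 2) (h₁₂ : ¬ ∃ b e : G, c₁ * c₂ = α b / b * e ^ 2) :
    ∀ a b : ℤ, (∃ b' e : G, c₁ ^ a * c₂ ^ b = α b' / b' * e ^ 2) → (2 : ℤ) ∣ a ∧ (2 : ℤ) ∣ b := by
  intro a b ⟨b', e, h⟩
  -- `c_k^x = (c_k^{x/2})² · c_k^{x mod 2}`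
  have hsplit : ∀ (c : G) (x : ℤ), c ^ x = (c ^ (x / 2)) ^ 2 * c ^ (x % 2) := fun c x => by
    conv_lhs => rw [← Int.ediv_mul_add_emod x 2]
    rw [zpow_add, zpow_mul, zpow_ofNat]
  set q : G := c₁ ^ (a / 2) * c₂ ^ (b / 2) with hq
  have key : c₁ ^ (a % 2) * c₂ ^ (b % 2) = α b' / b' * (e * q⁻¹) ^ 2 := by
    have h' : c₁ ^ (a % 2) * c₂ ^ (b % 2) * q ^ 2 = α b' / b' * e ^ 2 := by
      rw [← h, hsplit c₁ a, hsplit c₂ b, hq, mul_pow]; ac_rfl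
    rw [mul_pow, inv_pow, ← mul_assoc, ← h', mul_inv_cancel_right]
  rcases Int.emod_two_eq_zero_or_one a with ha | ha <;> rcases Int.emod_two_eq_zero_or_one b with hb | hb
  · exact ⟨Int.dvd_of_emod_eq_zero ha, Int.dvd_of_emod_eq_zero hb⟩
  · rw [ha, hb, zpow_zero, zpow_one, one_mul] at key
    exact absurd ⟨b', e * q⁻¹, key⟩ h₂
  · rw [ha, hb, zpow_zero, zpow_one, mul_one] at key
    exact absurd ⟨b', e * q⁻¹, key⟩ h₁
  · rw [ha, hb, zpow_one, zpow_one] at key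
    exact absurd ⟨b', e * q⁻¹, key⟩ h₁₂

end Literature.NumberTheory.IwasawaTheory.FukudaRelation

namespace Literature.NumberTheory.IwasawaTheory

open scoped NumberField nonZeroDivisors
open NumberField IsDedekindDomain Field Literature.NumberTheory.EllipticCurves Literature.NumberTheory.NumberFields
  Literature.NumberTheory.NumberFields.AmbiguousClass Literature.NumberTheory.GaloisRepresentations
  Literature.NumberTheory.GaloisRepresentations.Herbrand Literature.NumberTheory.GaloisRepresentations.MinkowskiUnit
  Literature.NumberTheory.GaloisRepresentations.CyclicNormIndex

/-! ## §2 `p = 2`: `rank₂ Cl(K_1) ≤ 2` for free when `h_K` is odd and `t₁ ≤ 3` -/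

section Two

variable {K : Type} [Field K] [NumberField K]

/-- ★ **`rank₂ Cl(K_1) ≤ 2`** when `h_K` is odd and at most THREE primes of `K` ramify in `K_1` (`κ` a `ℤ₂`-extension): the exact genus count
`rank₂ Cl(K_1) + 1 + ord₂ [E_K : E_K ∩ N K_1ˣ] = t₁ ≤ 3` (tree `classGroupPRank_one_add_one_add_padicValNat_eq_ncard`) — no unit datum is needed.
[cite: Gras2003, IV.4] [cite: Lang1990, Ch. 13 §4, Lemma 4.1 (PDF p. 203)] -/
theorem classGroupPRank_one_le_two_of_ncard_le_three (κ : ZpExtension K 2) [NumberField (κ.layer 1)] (hodd : Odd (classNumber K))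
    (ht : {v : HeightOneSpectrum (𝓞 K) | v.asIdeal.ramificationIdxIn (𝓞 (κ.layer 1)) ≠ 1}.ncard ≤ 3) :
    classGroupPRank κ 1 ≤ 2 := by
  have h := classGroupPRank_one_add_one_add_padicValNat_eq_ncard κ hodd
  omega

/-- ★★★ **THE TWO-GENERATOR RELATION DOOR AT `p = 2` (every layer, `μ₂ = 0`, `λ₂ ≤ d`).**  `κ` a `ℤ₂`-extension of `K` with Fukuda index `0`, `h_K` odd, at most
THREE primes of `K` ramified in `K_1` (so `rank₂ Cl(K_1) ≤ 2`); a layer `n ≥ 1` with `d + 2 ≤ 2^n`, `σ` a generator of `Gal(K_n/K)`, two classes `c₁, c₂ ∈ Cl(K_n)`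
independent modulo `σ(b)·b⁻¹·Cl²`, and a `2 × 2` relation matrix of determinant `(X−1)^d·u + 2·g`, `u(1)` odd.  THEN **`rank₂ Cl(K_m) ≤ d` for every `m`,
`μ₂(κ) = 0`, `λ₂(κ) ≤ d`**. [cite: Washington1997, §13.3 Prop. 13.22–13.23] [cite: Gras2003, IV.4] [cite: Lang1990, Ch. 5 §3, Ch. 13 §4 Lemma 4.1]
[cite: Fukuda1994, Thm. 1, p. 264] -/
theorem classicalMuVanishes_and_classicalLambda_le_of_relation_matrix_of_ncard_le_three (κ : ZpExtension K 2) (hκ : TotallyRamifiedFrom κ 0)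
    [NumberField (κ.layer 1)] (hodd : Odd (classNumber K))
    (ht : {v : HeightOneSpectrum (𝓞 K) | v.asIdeal.ramificationIdxIn (𝓞 (κ.layer 1)) ≠ 1}.ncard ≤ 3)
    {n : ℕ} (hn : 1 ≤ n) (σ : (κ.layer n) ≃ₐ[K] (κ.layer n)) (hσ : ∀ τ : (κ.layer n) ≃ₐ[K] (κ.layer n), τ ∈ Subgroup.zpowers σ)
    {c₁ c₂ : ClassGroup (𝓞 (κ.layer n))}
    (hc : ∀ a b : ℤ, (∃ b' e : ClassGroup (𝓞 (κ.layer n)), c₁ ^ a * c₂ ^ b = ClassGroup.mulEquiv (AmbiguousClass.intAut σ) b' / b' * e ^ 2) →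
      (2 : ℤ) ∣ a ∧ (2 : ℤ) ∣ b)
    {N d : ℕ} (hd : d + 2 ≤ 2 ^ n) {f₁₁ f₁₂ f₂₁ f₂₂ : ℕ → ℤ} {u g : ℤ[X]} (hu : ¬ (2 : ℤ) ∣ u.eval 1)
    (hF : (∑ i ∈ range N, C (f₁₁ i) * X ^ i : ℤ[X]) * (∑ i ∈ range N, C (f₂₂ i) * X ^ i) -
        (∑ i ∈ range N, C (f₁₂ i) * X ^ i) * (∑ i ∈ range N, C (f₂₁ i) * X ^ i) = (X - 1) ^ d * u + C (2 : ℤ) * g)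
    (hrel₁ : (∏ i ∈ range N, (ClassGroup.mulEquiv (AmbiguousClass.intAut (σ ^ i)) c₁) ^ (f₁₁ i)) *
        ∏ i ∈ range N, (ClassGroup.mulEquiv (AmbiguousClass.intAut (σ ^ i)) c₂) ^ (f₁₂ i) = 1)
    (hrel₂ : (∏ i ∈ range N, (ClassGroup.mulEquiv (AmbiguousClass.intAut (σ ^ i)) c₁) ^ (f₂₁ i)) *
        ∏ i ∈ range N, (ClassGroup.mulEquiv (AmbiguousClass.intAut (σ ^ i)) c₂) ^ (f₂₂ i) = 1) :
    (∀ m, classGroupPRank κ m ≤ d) ∧ ClassicalMuVanishes κ ∧ classicalLambda κ ≤ d := by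
  haveI : Fact (Nat.Prime 2) := ⟨Nat.prime_two⟩
  have h1 := classGroupPRank_one_le_two_of_ncard_le_three κ hodd ht
  have hu' : ¬ ((2 : ℕ) : ℤ) ∣ u.eval 1 := by exact_mod_cast hu
  have hc' : ∀ a b : ℤ, (∃ b' e : ClassGroup (𝓞 (κ.layer n)), c₁ ^ a * c₂ ^ b = ClassGroup.mulEquiv (AmbiguousClass.intAut σ) b' / b' * e ^ (2 : ℕ)) →
      ((2 : ℕ) : ℤ) ∣ a ∧ ((2 : ℕ) : ℤ) ∣ b := by exact_mod_cast hc
  have hF' : (∑ i ∈ range N, C (f₁₁ i) * X ^ i : ℤ[X]) * (∑ i ∈ range N, C (f₂₂ i) * X ^ i) -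
      (∑ i ∈ range N, C (f₁₂ i) * X ^ i) * (∑ i ∈ range N, C (f₂₁ i) * X ^ i) = (X - 1) ^ d * u + C (((2 : ℕ) : ℤ)) * g := by
    exact_mod_cast hF
  exact classicalMuVanishes_and_classicalLambda_le_of_relation_matrix_of_classGroupPRank_one_le_two κ hκ hn h1 σ hσ hc'
    (by exact_mod_cast hd) hu' hF' hrel₁ hrel₂

end Two

/-! ## §3 `p = 2`, base-field currency: odd degree, `2 ∤ d_K`, at most three primes above `2`, `κ` cyclotomic, THREE genus certificates -/

section Base

variable {K : Type} [Field K] [NumberField K]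

set_option maxHeartbeats 800000 in
/-- ★★★ **THE TWO-GENERATOR RELATION DOOR ON THE SPLIT STRATUM (any layer, base-field data).**  `K` of odd degree with `2 ∤ d_K` and AT MOST THREE primes above `2`,
`κ` a cyclotomic `ℤ₂`-extension, `2 ∤ h_K`; THREE GENUS CERTIFICATES: for `j ∈ {1, 2, 12}` a maximal `𝔭_j ∋ 2` with `𝓞_K/𝔭_j = 𝔽₂` at which every unit is
`≡ ±1 (mod 𝔭_j³)`, `π_j ≡ ±3 (mod 𝔭_j³)`, a nonzero ideal `𝔄_j` of `𝓞_{K_1}` with `N_{K_1/K}(𝔄_j)^{k_j} = (π_j)`, and `N_{K_m/K_1}(c₁) = [𝔄₁]`, `N_{K_m/K_1}(c₂) = [𝔄₂]`,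
`N_{K_m/K_1}(c₁c₂) = [𝔄₁₂]` (so `c₁`, `c₂`, `c₁c₂ ∉ σ(b)b⁻¹·Cl²`: tree `not_exists_eq_conj_div_mul_sq_of_genusCert_layer`); `σ` a generator of `Gal(K_m/K)`, `1 ≤ m`;
a `2 × 2` RELATION MATRIX `∏_{i<N} σ^i(c₁)^{f_{j1}(i)} ∏_{i<N} σ^i(c₂)^{f_{j2}(i)} = 1` (`j = 1,2`) with `F₁₁F₂₂ − F₁₂F₂₁ = (X−1)^d·u + 2·g`, `u(1)` odd, **`d + 2 ≤ 2^m`**.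
THEN **`rank₂ Cl(K_l) ≤ d` for every `l`, `μ₂(κ) = 0`, `λ₂(κ) ≤ d`**.  (Fukuda index `0` and `t₁ =` the number of dyadic primes by `2 ∤ d_K`; `rank₂ Cl(K_1) ≤ 2` for free;
habitat: `2 = 𝔭₁𝔭₂𝔭₃` with the fundamental unit `≡ ±1 (mod 8)` at all three dyadic embeddings.)
[cite: Washington1997, §13.1 Prop. 13.2, §13.3 Prop. 13.22–13.23] [cite: Gras2003, IV.4] [cite: Lang1990, Ch. 5 §3, Ch. 13 §4 Lemma 4.1] [cite: Omeara1963, §63B (63:10)]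
[cite: Fukuda1994, Thm. 1, p. 264] [cite: NeukirchANT1999, Ch. III (2.12)] -/
theorem classicalMuVanishes_two_of_relation_matrix_of_three_genusCerts (hK2 : ¬ 2 ∣ Module.finrank ℚ K)
    (hd : ¬ (2 : ℤ) ∣ NumberField.discr K) (κ : ZpExtension K 2) (hκ : κ.IsCyclotomic)
    (h3 : {w : HeightOneSpectrum (𝓞 K) | ((2 : ℕ) : 𝓞 K) ∈ w.asIdeal}.ncard ≤ 3)
    (hh : ¬ 2 ∣ classNumber K) {m : ℕ} (hm : 1 ≤ m)
    [NumberField (κ.layer 1)] [NumberField (κ.layer m)] [Algebra (κ.layer 1) (κ.layer m)]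
    [IsScalarTower K (κ.layer 1) (κ.layer m)]
    -- certificate for `c₁` at `𝔭₁`
    (P₁ : Ideal (𝓞 K)) [P₁.IsMaximal] (hres₁ : ∀ r : 𝓞 K, r ∈ P₁ ∨ r - 1 ∈ P₁) (h2P₁ : (2 : 𝓞 K) ∈ P₁)
    (hunits₁ : ∀ u : (𝓞 K)ˣ, (u : 𝓞 K) - 1 ∈ P₁ ^ 3 ∨ (u : 𝓞 K) + 1 ∈ P₁ ^ 3)
    {π₁ : 𝓞 K} (hπ₁ : π₁ - 3 ∈ P₁ ^ 3 ∨ π₁ + 3 ∈ P₁ ^ 3)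
    {A₁ : Ideal (𝓞 (κ.layer 1))} (hA₁0 : A₁ ≠ ⊥) {k₁ : ℕ} (hA₁ : Ideal.relNorm (𝓞 K) A₁ ^ k₁ = Ideal.span {π₁})
    -- certificate for `c₂` at `𝔭₂`
    (P₂ : Ideal (𝓞 K)) [P₂.IsMaximal] (hres₂ : ∀ r : 𝓞 K, r ∈ P₂ ∨ r - 1 ∈ P₂) (h2P₂ : (2 : 𝓞 K) ∈ P₂)
    (hunits₂ : ∀ u : (𝓞 K)ˣ, (u : 𝓞 K) - 1 ∈ P₂ ^ 3 ∨ (u : 𝓞 K) + 1 ∈ P₂ ^ 3)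
    {π₂ : 𝓞 K} (hπ₂ : π₂ - 3 ∈ P₂ ^ 3 ∨ π₂ + 3 ∈ P₂ ^ 3)
    {A₂ : Ideal (𝓞 (κ.layer 1))} (hA₂0 : A₂ ≠ ⊥) {k₂ : ℕ} (hA₂ : Ideal.relNorm (𝓞 K) A₂ ^ k₂ = Ideal.span {π₂})
    -- certificate for `c₁c₂` at `𝔭₁₂`
    (P₁₂ : Ideal (𝓞 K)) [P₁₂.IsMaximal] (hres₁₂ : ∀ r : 𝓞 K, r ∈ P₁₂ ∨ r - 1 ∈ P₁₂) (h2P₁₂ : (2 : 𝓞 K) ∈ P₁₂)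
    (hunits₁₂ : ∀ u : (𝓞 K)ˣ, (u : 𝓞 K) - 1 ∈ P₁₂ ^ 3 ∨ (u : 𝓞 K) + 1 ∈ P₁₂ ^ 3)
    {π₁₂ : 𝓞 K} (hπ₁₂ : π₁₂ - 3 ∈ P₁₂ ^ 3 ∨ π₁₂ + 3 ∈ P₁₂ ^ 3)
    {A₁₂ : Ideal (𝓞 (κ.layer 1))} (hA₁₂0 : A₁₂ ≠ ⊥) {k₁₂ : ℕ} (hA₁₂ : Ideal.relNorm (𝓞 K) A₁₂ ^ k₁₂ = Ideal.span {π₁₂})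
    -- the two classes and their norms to `K_1`
    (σ : (κ.layer m) ≃ₐ[K] (κ.layer m)) (hσ : ∀ τ : (κ.layer m) ≃ₐ[K] (κ.layer m), τ ∈ Subgroup.zpowers σ)
    {c₁ c₂ : ClassGroup (𝓞 (κ.layer m))}
    (hcA₁ : classGroupNorm (κ.layer 1) (κ.layer m) c₁ = ClassGroup.mk0 ⟨A₁, mem_nonZeroDivisors_of_ne_zero hA₁0⟩)
    (hcA₂ : classGroupNorm (κ.layer 1) (κ.layer m) c₂ = ClassGroup.mk0 ⟨A₂, mem_nonZeroDivisors_of_ne_zero hA₂0⟩)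
    (hcA₁₂ : classGroupNorm (κ.layer 1) (κ.layer m) (c₁ * c₂) = ClassGroup.mk0 ⟨A₁₂, mem_nonZeroDivisors_of_ne_zero hA₁₂0⟩)
    -- the relation matrix
    {N d : ℕ} (hd2 : d + 2 ≤ 2 ^ m) {f₁₁ f₁₂ f₂₁ f₂₂ : ℕ → ℤ} {u g : ℤ[X]} (hu : ¬ (2 : ℤ) ∣ u.eval 1)
    (hF : (∑ i ∈ range N, C (f₁₁ i) * X ^ i : ℤ[X]) * (∑ i ∈ range N, C (f₂₂ i) * X ^ i) -
        (∑ i ∈ range N, C (f₁₂ i) * X ^ i) * (∑ i ∈ range N, C (f₂₁ i) * X ^ i) = (X - 1) ^ d * u + C (2 : ℤ) * g)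
    (hrel₁ : (∏ i ∈ range N, (ClassGroup.mulEquiv (intAut (σ ^ i)) c₁) ^ (f₁₁ i)) *
        ∏ i ∈ range N, (ClassGroup.mulEquiv (intAut (σ ^ i)) c₂) ^ (f₁₂ i) = 1)
    (hrel₂ : (∏ i ∈ range N, (ClassGroup.mulEquiv (intAut (σ ^ i)) c₁) ^ (f₂₁ i)) *
        ∏ i ∈ range N, (ClassGroup.mulEquiv (intAut (σ ^ i)) c₂) ^ (f₂₂ i) = 1) :
    (∀ l, classGroupPRank κ l ≤ d) ∧ ClassicalMuVanishes κ ∧ classicalLambda κ ≤ d := by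
  classical
  haveI : Fact (Nat.Prime 2) := ⟨Nat.prime_two⟩
  haveI : FiniteDimensional K (κ.layer 1) := κ.finiteDimensional_layer_holds 1
  haveI : IsGalois K (κ.layer 1) := κ.isGalois_layer_holds 1
  have hodd := forall_odd_ramificationIdx_of_not_dvd_discr hd
  have hκ0 : TotallyRamifiedFrom κ 0 := totallyRamifiedFrom_zero_of_forall_odd_ramificationIdx hK2 κ hκ hodd
  have hhodd : Odd (classNumber K) := Nat.odd_iff.mpr (Nat.two_dvd_ne_zero.mp hh)
  -- the three generator certificates
  have hc₁ := not_exists_eq_conj_div_mul_sq_of_genusCert_layer hK2 hd κ hκ hh m P₁ hres₁ h2P₁ hunits₁ hπ₁ hA₁0 hA₁ σ hcA₁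
  have hc₂ := not_exists_eq_conj_div_mul_sq_of_genusCert_layer hK2 hd κ hκ hh m P₂ hres₂ h2P₂ hunits₂ hπ₂ hA₂0 hA₂ σ hcA₂
  have hc₁₂ := not_exists_eq_conj_div_mul_sq_of_genusCert_layer hK2 hd κ hκ hh m P₁₂ hres₁₂ h2P₁₂ hunits₁₂ hπ₁₂ hA₁₂0 hA₁₂ σ hcA₁₂
  have hc := FukudaRelation.forall_dvd_two_of_not_exists_eq_conj_div_mul_sq (ClassGroup.mulEquiv (intAut σ)) hc₁ hc₂ hc₁₂
  -- `t₁ ≤ 3`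
  have ht : {v : HeightOneSpectrum (𝓞 K) | v.asIdeal.ramificationIdxIn (𝓞 (κ.layer 1)) ≠ 1}.ncard ≤ 3 := by
    rw [ncard_ramified_layer_eq_ncard_dyadic hK2 κ hκ hodd le_rfl]
    exact h3
  exact classicalMuVanishes_and_classicalLambda_le_of_relation_matrix_of_ncard_le_three κ hκ0 hhodd ht hm σ hσ hc hd2 hu hF hrel₁ hrel₂

end Base

end Literature.NumberTheory.IwasawaTheory

end
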